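import Mathlib
import Literature.NumberTheory.Transcendental.KZCalculusProofs
import Literature.NumberTheory.Transcendental.KZLogCalculusProofs
import Literature.NumberTheory.Transcendental.KZHomotopyMoves
import Literature.NumberTheory.Transcendental.KZProductIdeal
import Literature.NumberTheory.Transcendental.KZSemialgebraicComplex
import Literature.NumberTheory.Transcendental.KZIdealTetrahedron
import Literature.NumberTheory.Transcendental.KZIntervalPeriodProofs
import Literature.NumberTheory.Transcendental.KZDominatedFamilyRelations
import Summits.KontsevichZagierPeriods.KontsevichZagierPeriods.Theorems.HyperbolicBlochOffTetraSectorKernelStubGoldenDilog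
import Summits.KontsevichZagierPeriods.KontsevichZagierPeriods.Theorems.HyperbolicBlochOffTetraSectorKernelAbelFiveTermDilog

/-!
# `OffTetraSectorKernel`, line `odd-hyperbolic-ladder` (v9): Abel's five-term equation — the strip `Li₂(x) − Li₂(X)` and the swept region

The two terms `[T x] − [T X]` of Abel's equation (`X = x(1−y)/(1−xy) < x`) are move-equivalent to the
unfolded-logarithm band `CX = [{0<t<y, 1 ≤ w ≤ P(t)}, (1−x)/((1−xt)(1−t)w)]`, `P(t) = (1−xt)/(1−x)`:
dissect `T x` along the null line `u = X` into `T X` and the strip `{X < u < x}` (rule (1a)), shear the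
strip to the rectangle (`stub_dilogShear`), pass to the band (`stub_stripToLogBand`) and change the base
by the decreasing Möbius map `u = X(t) = x(1−t)/(1−xt)` (`stub_moebiusCovLift`).

Second part — INTEGRATION BY PARTS INSIDE THE CALCULUS, first half: the region
`R = {1 < w < Q₁, 1 < u < w/(w−x)}` swept by the curve `t ↦ (P(t), Q(t)) = ((1−xt)/(1−x), (1−xt)/(1−t))`
(integrand `1/(uw)`) is, after a coordinate swap, the closing of its fibres and the Möbius base change
`w = Q(t)`, the SAME band `CX` (`abel_swept_sub_CX`).

References: M. Kontsevich, D. Zagier, *Periods* (2001), §1.2.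
-/

noncomputable section

open Set MeasureTheory
open Literature.NumberTheory.Transcendental Literature.ModelTheory.ExponentialFields

namespace Summit.KontsevichZagierPeriods.HyperbolicBloch.OffTetraSectorKernel

/-! ### The terms `Li₂(x) − Li₂(X)`: dissection and base change `u = X(t) = x(1−t)/(1−xt)` -/

/-- `1/(1 − X(t)) = P(t) = (1 − xt)/(1 − x)` on the homotopy interval. [folklore] -/
theorem abel_vX_eq {x t : ℝ} (hx1 : x < 1) (ht1 : t < 1) (hx0 : 0 < x) :
    1 / (1 - (-x * t + x) / (-x * t + 1)) = (1 - x * t) / (1 - x) := by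
  have h1 : 1 - x * t ≠ 0 := by nlinarith
  rw [show -x * t + 1 = 1 - x * t by ring, one_sub_div h1, one_div_div]
  congr 1
  ring

/-- The strip `{X < u < x, 0 < t < u}` is `ℚ`-semialgebraic for real-algebraic `X, x`.
[cite: KontsevichZagier2001, §1.1] -/
theorem abel_isSemialgebraic_strip {α β : ℝ} (hα : IsAlgebraic ℚ α) (hβ : IsAlgebraic ℚ β) :
    IsSemialgebraic ℚ {w : Fin 2 → ℝ | α < w 0 ∧ w 0 < β ∧ 0 < w 1 ∧ w 1 < w 0} := by
  have hU : IsSemialgebraic ℚ (univ : Set (Fin 2 → ℝ)) := isSemialgebraic_univ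
  have hco : ∀ i : Fin 2, IsSemialgebraicFunOn ℚ (univ : Set (Fin 2 → ℝ)) (fun p => p i) :=
    fun i => isSemialgebraicFunOn_apply hU i
  have hc : ∀ {c : ℝ}, IsAlgebraic ℚ c → IsSemialgebraicFunOn ℚ (univ : Set (Fin 2 → ℝ)) (fun _ => c) :=
    fun h => isSemialgebraicFunOn_const_of_isAlgebraic hU h
  have S1 := isSemialgebraic_setOf_lt_of_isSemialgebraicFunOn (hc hα) (hco 0)
  have S2 := isSemialgebraic_setOf_lt_of_isSemialgebraicFunOn (hco 0) (hc hβ)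
  have S3 := isSemialgebraic_setOf_lt_of_isSemialgebraicFunOn (hc isAlgebraic_zero) (hco 1)
  have S4 := isSemialgebraic_setOf_lt_of_isSemialgebraicFunOn (hco 1) (hco 0)
  convert S1.inter (S2.inter (S3.inter S4)) using 1
  ext w
  simp only [mem_inter_iff, mem_setOf_eq]

/-- **`[T x] − [T X] ≡ [CX]`**, `CX = [{0<t<y, 1 ≤ w ≤ P(t)}, (1−x)/((1−xt)(1−t)w)]`: dissect the triangle
`T x` along the null line `u = X` into `T X` and the strip `{X<u<x}` (rule (1a)), shear the strip to the
rectangle `(X,x)×(0,1)` (`stub_dilogShear`), pass to the band (`stub_stripToLogBand`) and change the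
base by the decreasing Möbius map `u = X(t)` (`stub_moebiusCovLift`, `(a,b,c,d) = (−x, x, −x, 1)`,
`|X′| = x(1−x)/(1−xt)²`, `(|X′|/X)(t) = (1−x)/((1−xt)(1−t)) = (Q′/Q)(t)`).
[cite: KontsevichZagier2001, §1.2] -/
theorem abel_term_X :
    ∀ (x y : ℝ), IsAlgebraic ℚ x → IsAlgebraic ℚ y → 0 < x → x < 1 → 0 < y → y < 1 →
    ∀ (Lx LX CX : KZ.IntegralRep 2),
      Lx.domain = {w | 0 < w 1 ∧ w 1 < w 0 ∧ w 0 < x} →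
      Set.EqOn Lx.integrand (fun w => 1 / (w 0 * (1 - w 1))) Lx.domain →
      LX.domain = {w | 0 < w 1 ∧ w 1 < w 0 ∧ w 0 < x * (1 - y) / (1 - x * y)} →
      Set.EqOn LX.integrand (fun w => 1 / (w 0 * (1 - w 1))) LX.domain →
      CX.domain = {z | (0 < z 0 ∧ z 0 < y) ∧ 1 ≤ z 1 ∧ z 1 ≤ (1 - x * z 0) / (1 - x)} →
      Set.EqOn CX.integrand (fun z => (1 - x) / ((1 - x * z 0) * (1 - z 0) * z 1)) CX.domain →
      KZ.of Lx - KZ.of LX - KZ.of CX ∈ KZ.relations := by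
  intro x y hx hy hx0 hx1 hy0 hy1 Lx LX CX hLx hLxi hLX hLXi hCX hCXi
  set X₁ : ℝ := x * (1 - y) / (1 - x * y) with hX₁
  have hX0 : 0 < X₁ := abel_X_pos hx0 hx1 hy1
  have hXx : X₁ < x := abel_X_lt hx0 hx1 hy0 hy1
  have hxy : 0 < 1 - x * y := abel_one_sub_mul_pos hx0 hx1 hy1
  have hXalg : IsAlgebraic ℚ X₁ :=
    (hx.mul (isAlgebraic_one.sub hy)).mul (isAlgebraic_one.sub (hx.mul hy)).inv
  -- the two pieces of `T x` off the null line `u = X₁`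
  set SL : Set (Fin 2 → ℝ) := {w | 0 < w 1 ∧ w 1 < w 0 ∧ w 0 < X₁} with hSL
  set SR : Set (Fin 2 → ℝ) := {w | X₁ < w 0 ∧ w 0 < x ∧ 0 < w 1 ∧ w 1 < w 0} with hSR
  have hSLsa : IsSemialgebraic ℚ SL := goldenDilog_isSemialgebraic_triangle hXalg
  have hSRsa : IsSemialgebraic ℚ SR := abel_isSemialgebraic_strip hXalg hx
  have hSLsub : SL ⊆ Lx.domain := by
    rw [hLx]; rintro w ⟨h1, h2, h3⟩; exact ⟨h1, h2, h3.trans hXx⟩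
  have hSRsub : SR ⊆ Lx.domain := by
    rw [hLx]; rintro w ⟨-, h2, h3, h4⟩; exact ⟨h3, h4, h2⟩
  have hS'sa : IsSemialgebraic ℚ (SL ∪ SR) := hSLsa.union hSRsa
  have hS'sub : SL ∪ SR ⊆ Lx.domain := union_subset hSLsub hSRsub
  have hnull : volume (Lx.domain \ (SL ∪ SR)) = 0 := by
    refine measure_mono_null (fun w hw => ?_) (by
      rw [volume_pi]
      exact Measure.pi_hyperplane (fun _ : Fin 2 => (volume : Measure ℝ)) (0 : Fin 2) X₁ :
      volume {w : Fin 2 → ℝ | w 0 = X₁} = 0)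
    rw [hLx] at hw
    obtain ⟨⟨h1, h2, h3⟩, hw⟩ := hw
    simp only [mem_union, hSL, hSR, mem_setOf_eq, not_or] at hw
    obtain ⟨hwL, hwR⟩ := hw
    by_contra hne
    rcases lt_or_gt_of_ne hne with hlt | hgt
    · exact hwL ⟨h1, h2, hlt⟩
    · exact hwR ⟨hgt, h3, h1, h2⟩
  set Lx' := Lx.restrict (SL ∪ SR) hS'sa hS'sub with hLx'
  set LxL := Lx.restrict SL hSLsa hSLsub with hLxL
  set LxR := Lx.restrict SR hSRsa hSRsub with hLxR
  have h4a : KZ.of Lx - KZ.of Lx' ∈ KZ.relations := Lx.of_sub_of_restrict_mem_relations hS'sa hS'sub hnull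
  have h4b : KZ.of Lx' - KZ.of LxL - KZ.of LxR ∈ KZ.relations := by
    refine KZ.domainAddRel_subset_relations ⟨2, Lx', LxL, LxR, rfl, ?_, fun _ _ => rfl, fun _ _ => rfl, rfl⟩
    have : LxL.domain ∩ LxR.domain = ∅ := by
      ext w
      simp only [hLxL, hLxR, KZ.IntegralRep.domain_restrict, hSL, hSR, mem_inter_iff, mem_setOf_eq,
        mem_empty_iff_false, iff_false, not_and]
      rintro ⟨-, -, h3⟩ h4
      intros; linarith
    rw [this, measure_empty]
  have h4c : KZ.of LxL - KZ.of LX ∈ KZ.relations := by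
    refine KZ.of_sub_of_mem_relations_of_eqOn (by rw [hLX, hLxL, KZ.IntegralRep.domain_restrict])
      fun w hw => ?_
    have hw' : w ∈ SL := by simpa [hLxL] using hw
    rw [hLxL, KZ.IntegralRep.integrand_restrict, hLxi (hSLsub hw'), hLXi (by rw [hLX]; exact hw')]
  -- the strip: shear, band, base change
  obtain ⟨R, hRd, hRi⟩ := abel_exists_dilogRect hXalg hx hX0.le hx1
  obtain ⟨B, hBd, hBi⟩ := abel_exists_dilogBand X₁ x hXalg hx hX0.le hx1
  have h4d : KZ.of LxR - KZ.of R ∈ KZ.relations :=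
    stub_dilogShear X₁ x hXalg hx hX0.le hXx hx1.le LxR R (by rw [hLxR, KZ.IntegralRep.domain_restrict])
      (fun w hw => by
        have hw' : w ∈ SR := by simpa [hLxR] using hw
        rw [hLxR, KZ.IntegralRep.integrand_restrict, hLxi (hSRsub hw')])
      hRd (fun w _ => by rw [hRi])
  have h4e : KZ.of R - KZ.of B ∈ KZ.relations :=
    stub_stripToLogBand X₁ x hXalg hx hX0.le hXx hx1.le R B hRd (fun w _ => by rw [hRi]) hBd
      (fun w _ => by rw [hBi]; simp only [div_div])
  have hmy : (-x * y + x) / (-x * y + 1) = X₁ := by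
    rw [hX₁]; congr 1 <;> ring
  have hm0 : (-x * 0 + x) / (-x * 0 + 1) = x := by simp
  have h4f : KZ.of CX - KZ.of B ∈ KZ.relations := by
    refine stub_moebiusCovLift (-x) x (-x) 1 0 y hx.neg hx hx.neg isAlgebraic_one isAlgebraic_zero hy
      hy0 (by nlinarith) (fun t ht => by have := ht.2; nlinarith)
      (fun p => 1 / (1 - (-x * p 0 + x) / (-x * p 0 + 1))) (fun q => 1 / (1 - q 0))
      (fun p _ _ => rfl) CX B ?_ ?_ ?_
    · rw [hCX]
      ext z
      simp only [mem_setOf_eq]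
      constructor
      · rintro ⟨⟨h0, h1⟩, h2, h3⟩
        exact ⟨⟨h0, h1⟩, h2, by rwa [abel_vX_eq hx1 (h1.trans hy1) hx0]⟩
      · rintro ⟨⟨h0, h1⟩, h2, h3⟩
        exact ⟨⟨h0, h1⟩, h2, by rwa [abel_vX_eq hx1 (h1.trans hy1) hx0] at h3⟩
    · rw [hBd]
      ext z
      have hmin : min ((-x * 0 + x) / (-x * 0 + 1)) ((-x * y + x) / (-x * y + 1)) = X₁ := by
        rw [hmy, hm0]; exact min_eq_right hXx.le
      have hmax : max ((-x * 0 + x) / (-x * 0 + 1)) ((-x * y + x) / (-x * y + 1)) = x := by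
        rw [hmy, hm0]; exact max_eq_left hXx.le
      simp only [mem_setOf_eq, hmin, hmax, and_assoc]
    · intro z hz
      have hz' := hz
      rw [hCX] at hz'
      obtain ⟨⟨hz0, hzy⟩, hz1, -⟩ := hz'
      rw [hCXi hz, hBi]
      have habs : |(-x) * 1 - x * -x| = x * (1 - x) := by
        rw [show (-x) * 1 - x * -x = -(x * (1 - x)) by ring, abs_neg, abs_of_pos (by nlinarith)]
      simp only [Matrix.cons_val_zero, Matrix.cons_val_one, habs]
      have hz1' : z 1 ≠ 0 := by positivity
      have h4 : 1 - x * z 0 ≠ 0 := by nlinarith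
      have h5 : 1 - x ≠ 0 := by linarith
      have h6 : 1 - z 0 ≠ 0 := by linarith
      have h8 : x ≠ 0 := hx0.ne'
      rw [one_div_div, show -x * z 0 + x = x * (1 - z 0) by ring, show -x * z 0 + 1 = 1 - x * z 0 by ring]
      field_simp
  have : KZ.of Lx - KZ.of LX - KZ.of CX = (KZ.of Lx - KZ.of Lx') + (KZ.of Lx' - KZ.of LxL - KZ.of LxR) +
      (KZ.of LxL - KZ.of LX) + (KZ.of LxR - KZ.of R) + (KZ.of R - KZ.of B) - (KZ.of CX - KZ.of B) := by
    abel
  rw [this]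
  refine KZ.relations.sub_mem (KZ.relations.add_mem (KZ.relations.add_mem (KZ.relations.add_mem
    (KZ.relations.add_mem h4a h4b) h4c) h4d) h4e) h4f

/-! ## The swept region (integration by parts, first half) -/

/-! ### Scalar facts -/

/-- `1 < Q₁ = (1−xy)/(1−y)`. [folklore] -/
theorem abel_one_lt_Q₁ {x y : ℝ} (hx1 : x < 1) (hy0 : 0 < y) (hy1 : y < 1) :
    1 < (1 - x * y) / (1 - y) := by
  rw [lt_div_iff₀ (by linarith)]; nlinarith

/-- `P₁ < 1/(1−x)`. [folklore] -/
theorem abel_P₁_lt {x y : ℝ} (hx0 : 0 < x) (hx1 : x < 1) (hy0 : 0 < y) :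
    (1 - x * y) / (1 - x) < 1 / (1 - x) := by
  apply div_lt_div_of_pos_right _ (by linarith)
  nlinarith [mul_pos hx0 hy0]

/-- `Q(t)/(Q(t) − x) = P(t)`: `m/(m − x) = (1−xt)/(1−x)` for `m = (−xt+1)/(−1·t+1)`. [folklore] -/
theorem abel_vP_eq {x t : ℝ} (ht1 : t < 1) :
    (-x * t + 1) / (-1 * t + 1) / ((-x * t + 1) / (-1 * t + 1) - x) = (1 - x * t) / (1 - x) := by
  have h1 : -1 * t + 1 ≠ 0 := by linarith
  have e : (-1 : ℝ) * t + 1 = 1 - t := by ring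
  have h1' : 1 - t ≠ 0 := by linarith
  have h3 : (-x * t + 1) / (-1 * t + 1) - x = (1 - x) / (-1 * t + 1) := by
    rw [e, eq_div_iff h1', sub_mul, div_mul_cancel₀ _ h1']
    ring
  rw [h3, div_div_div_cancel_right₀ h1]
  congr 1; ring

/-- `x P(t)/(P(t) − 1) = Q(t)`: `x m/(m − 1) = (1−xt)/(1−t)` for `m = (−xt+1)/(0·t+(1−x))`. [folklore] -/
theorem abel_vQ_eq {x t : ℝ} (hx0 : 0 < x) (hx1 : x < 1) (ht1 : t < 1) :
    x * ((-x * t + 1) / (0 * t + (1 - x))) / ((-x * t + 1) / (0 * t + (1 - x)) - 1) =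
      (1 - x * t) / (1 - t) := by
  have h2 : 1 - x ≠ 0 := by linarith
  have h4 : 1 - t ≠ 0 := by linarith
  have h5 : x ≠ 0 := hx0.ne'
  rw [show 0 * t + (1 - x) = 1 - x by ring]
  have h3 : (-x * t + 1) / (1 - x) - 1 = x * (1 - t) / (1 - x) := by
    field_simp; ring
  rw [h3, mul_div_assoc', div_div_div_cancel_right₀ h2]
  field_simp
  ring

/-- `x P₁/(P₁ − 1) = Q₁`. [folklore] -/
theorem abel_xP₁_div {x y : ℝ} (hx0 : 0 < x) (hx1 : x < 1) (hy1 : y < 1) :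
    x * ((1 - x * y) / (1 - x)) / ((1 - x * y) / (1 - x) - 1) = (1 - x * y) / (1 - y) := by
  have h := abel_vQ_eq (t := y) hx0 hx1 hy1
  rwa [show 0 * y + (1 - x) = 1 - x by ring, show -x * y + 1 = 1 - x * y by ring] at h

/-! ### The swept region `R` is the band `CX` -/

/-- **`[R] ≡ [CX]`**: the swept region `R = {1 < w < Q₁, 1 < u < w/(w−x)}` (integrand `1/(uw)`), after the
coordinate swap (rule (2)), the closing of its fibres (null graphs) and the Möbius base change
`w = Q(t) = (1−xt)/(1−t)` (`stub_moebiusCovLift`, `(a,b,c,d) = (−x,1,−1,1)`, `Q/(Q−x) = P`,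
`Q′/Q = (1−x)/((1−xt)(1−t))`), is the band `CX = [{0<t<y, 1 ≤ w ≤ P(t)}, (1−x)/((1−xt)(1−t)w)]`.
[cite: KontsevichZagier2001, §1.2 rule (2)] -/
theorem abel_swept_sub_CX :
    ∀ (x y : ℝ), IsAlgebraic ℚ x → IsAlgebraic ℚ y → 0 < x → x < 1 → 0 < y → y < 1 →
    ∀ (R CX : KZ.IntegralRep 2),
      R.domain = {w | 1 < w 0 ∧ w 0 * (w 1 - x) < w 1 ∧ 1 < w 1 ∧ w 1 < (1 - x * y) / (1 - y)} →
      Set.EqOn R.integrand (fun w => 1 / (w 0 * w 1)) R.domain →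
      CX.domain = {z | (0 < z 0 ∧ z 0 < y) ∧ 1 ≤ z 1 ∧ z 1 ≤ (1 - x * z 0) / (1 - x)} →
      Set.EqOn CX.integrand (fun z => (1 - x) / ((1 - x * z 0) * (1 - z 0) * z 1)) CX.domain →
      KZ.of R - KZ.of CX ∈ KZ.relations := by
  intro x y hx hy hx0 hx1 hy0 hy1 R CX hR hRi hCX hCXi
  set Q₁ : ℝ := (1 - x * y) / (1 - y) with hQ₁
  have hQ1 : 1 < Q₁ := abel_one_lt_Q₁ hx1 hy0 hy1
  have hQalg : IsAlgebraic ℚ Q₁ := (isAlgebraic_one.sub (hx.mul hy)).mul (isAlgebraic_one.sub hy).inv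
  -- swap the coordinates: base `w` first, fibre `u` last
  set R' := R.reindex (Equiv.swap (0 : Fin 2) 1) with hR'
  have s2 : KZ.of R - KZ.of R' ∈ KZ.relations := KZ.of_sub_of_reindex_mem_relations R _
  -- the closed band over `(1, Q₁)` with fibre `[1, w/(w−x)]`
  have hσ : IsSemialgebraic ℚ {p : Fin 1 → ℝ | 1 < p 0 ∧ p 0 < Q₁} := isSemialgebraic_logIvl isAlgebraic_one hQalg
  have hG : IsSemialgebraicFunOn ℚ {p : Fin 1 → ℝ | 1 < p 0 ∧ p 0 < Q₁} (fun p => 1 / p 0) :=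
    (abel_isSemialgebraicFunOn_moebius hσ 0 isAlgebraic_zero isAlgebraic_one isAlgebraic_one
      isAlgebraic_zero (fun p hp => by have := hp.1; simp; linarith)).congr fun p _ => by simp
  have hV : IsSemialgebraicFunOn ℚ {p : Fin 1 → ℝ | 1 < p 0 ∧ p 0 < Q₁} (fun p => p 0 / (p 0 - x)) :=
    (abel_isSemialgebraicFunOn_moebius hσ 0 isAlgebraic_one isAlgebraic_zero isAlgebraic_one
      hx.neg (fun p hp => by have := hp.1; linarith)).congr fun p _ => by simp; ring
  obtain ⟨B, hBd, hBi⟩ := abel_exists_band isAlgebraic_one hQalg (fun w => 1 / w) (fun w => w / (w - x))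
    (x / (1 - x)) hG hV (fun t ht1 _ => by
      rw [le_div_iff₀ (by linarith)]; linarith) (fun t ht1 _ => by
      have htx : 0 < t - x := by linarith
      have h1 : t / (t - x) - 1 = x / (t - x) := by field_simp; ring
      rw [h1, abs_of_pos (by positivity)]
      calc 1 / t * (x / (t - x)) ≤ 1 * (x / (1 - x)) := by
            apply mul_le_mul _ _ (by positivity) zero_le_one
            · rw [div_le_one (by linarith)]; linarith
            · exact div_le_div_of_nonneg_left hx0.le (by linarith) (by linarith)
        _ = x / (1 - x) := one_mul _)
  -- open the fibres
  have ha : IsSemialgebraicFunOn ℚ {p : Fin 1 → ℝ | 1 < p 0 ∧ p 0 < Q₁} (fun _ => (1 : ℝ)) := by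
    simpa using isSemialgebraicFunOn_ratCast hσ 1
  obtain ⟨Ro, hRod, hRoi, s3⟩ := KZ.of_sub_of_restrict_openBand_mem_relations ha hV B (by
    rw [hBd]; ext z
    simp only [mem_setOf_eq, KZlog.band, Fin.init, Fin.castSucc_zero, Fin.last]
    rfl)
  have s4 : KZ.of Ro - KZ.of R' ∈ KZ.relations := by
    refine KZ.of_sub_of_mem_relations_of_eqOn ?_ fun z hz => ?_
    · rw [hR', KZ.IntegralRep.reindex_domain, hR, hRod]
      ext z
      simp only [mem_setOf_eq, Equiv.swap_apply_left, Equiv.swap_apply_right, Fin.init,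
        Fin.castSucc_zero, Fin.last]
      change (1 < z 1 ∧ z 1 * (z 0 - x) < z 0 ∧ 1 < z 0 ∧ z 0 < Q₁) ↔
        ((1 < z 0 ∧ z 0 < Q₁) ∧ 1 < z 1 ∧ z 1 < z 0 / (z 0 - x))
      constructor
      · rintro ⟨h1, h2, h3, h4⟩
        exact ⟨⟨h3, h4⟩, h1, by rw [lt_div_iff₀ (by linarith)]; linarith⟩
      · rintro ⟨⟨h3, h4⟩, h1, h2⟩
        exact ⟨h1, by rw [lt_div_iff₀ (by linarith)] at h2; linarith, h3, h4⟩
    · have hz' : (fun i => z (Equiv.swap (0 : Fin 2) 1 i)) ∈ R.domain := by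
        have : z ∈ R'.domain := by
          rw [hR', KZ.IntegralRep.reindex_domain]
          rw [hRod] at hz
          simp only [mem_setOf_eq, Fin.init, Fin.castSucc_zero, Fin.last] at hz
          change (1 < z 0 ∧ z 0 < Q₁) ∧ 1 < z 1 ∧ z 1 < z 0 / (z 0 - x) at hz
          obtain ⟨⟨h3, h4⟩, h1, h2⟩ := hz
          rw [hR]
          simp only [mem_setOf_eq, Equiv.swap_apply_left, Equiv.swap_apply_right]
          exact ⟨h1, by rw [lt_div_iff₀ (by linarith)] at h2; linarith, h3, h4⟩
        simpa [hR', KZ.IntegralRep.reindex_domain] using this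
      rw [hRoi, hBi, hR', KZ.IntegralRep.reindex_integrand]
      simp only [hRi hz', Equiv.swap_apply_left, Equiv.swap_apply_right]
      rw [div_div, mul_comm]
  -- the base change `w = Q(t)`
  have hmy : (-x * y + 1) / (-1 * y + 1) = Q₁ := by rw [hQ₁]; congr 1 <;> ring
  have hm0 : (-x * 0 + 1) / (-1 * 0 + 1) = (1 : ℝ) := by simp
  have s5 : KZ.of CX - KZ.of B ∈ KZ.relations := by
    refine stub_moebiusCovLift (-x) 1 (-1) 1 0 y hx.neg isAlgebraic_one isAlgebraic_one.neg
      isAlgebraic_one isAlgebraic_zero hy hy0 (by nlinarith) (fun t ht => by have := ht.2; nlinarith)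
      (fun p => (-x * p 0 + 1) / (-1 * p 0 + 1) / ((-x * p 0 + 1) / (-1 * p 0 + 1) - x))
      (fun q => q 0 / (q 0 - x)) (fun p _ _ => rfl) CX B ?_ ?_ ?_
    · rw [hCX]
      ext z
      simp only [mem_setOf_eq]
      constructor
      · rintro ⟨⟨h0, h1⟩, h2, h3⟩
        exact ⟨⟨h0, h1⟩, h2, by rwa [abel_vP_eq (h1.trans hy1)]⟩
      · rintro ⟨⟨h0, h1⟩, h2, h3⟩
        exact ⟨⟨h0, h1⟩, h2, by rwa [abel_vP_eq (h1.trans hy1)] at h3⟩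
    · rw [hBd]
      ext z
      have hmin : min ((-x * 0 + 1) / (-1 * 0 + 1)) ((-x * y + 1) / (-1 * y + 1)) = 1 := by
        rw [hmy, hm0]; exact min_eq_left hQ1.le
      have hmax : max ((-x * 0 + 1) / (-1 * 0 + 1)) ((-x * y + 1) / (-1 * y + 1)) = Q₁ := by
        rw [hmy, hm0]; exact max_eq_right hQ1.le
      simp only [mem_setOf_eq, hmin, hmax]
    · intro z hz
      have hz' := hz
      rw [hCX] at hz'
      obtain ⟨⟨hz0, hzy⟩, hz1, -⟩ := hz'
      rw [hCXi hz, hBi]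
      have habs : |(-x) * 1 - 1 * -1| = 1 - x := by
        rw [show (-x) * 1 - 1 * -1 = 1 - x by ring, abs_of_pos (by linarith)]
      simp only [Matrix.cons_val_zero, Matrix.cons_val_one, habs]
      have hz1' : z 1 ≠ 0 := by positivity
      have h4 : 1 - x * z 0 ≠ 0 := by nlinarith
      have h5 : 1 - x ≠ 0 := by linarith
      have h6 : 1 - z 0 ≠ 0 := by linarith
      rw [one_div_div, show -1 * z 0 + 1 = 1 - z 0 by ring, show -x * z 0 + 1 = 1 - x * z 0 by ring]
      field_simp
  have : KZ.of R - KZ.of CX = (KZ.of R - KZ.of R') - (KZ.of Ro - KZ.of R') - (KZ.of B - KZ.of Ro) -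
      (KZ.of CX - KZ.of B) := by abel
  rw [this]
  exact KZ.relations.sub_mem (KZ.relations.sub_mem (KZ.relations.sub_mem s2 s4) s3) s5

end Summit.KontsevichZagierPeriods.HyperbolicBloch.OffTetraSectorKernel

end
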